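import Literature.NumberTheory.LFunctions.WeilMarkovQuadratic
import Mathlib.Analysis.SpecialFunctions.Integrals.Basic
import Mathlib.Analysis.SpecialFunctions.Log.Deriv
import Mathlib.Analysis.SpecialFunctions.Sqrt
import Mathlib.MeasureTheory.Integral.IntervalIntegral.FundThmCalculus
import Mathlib.MeasureTheory.Function.SpecialFunctions.Basic

/-!
# Auxiliary lemmas for stub `stub_surplusCalculus`
(line `borderline-barrier`, crux `WeilWindowFlow.WindowLipschitz`, item stmt-RiemannHypothesis-1039)

One-variable calculus of the two-scale barrier profile `W(s) = 1/√(log (1/s))` behind the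
surplus inequality `stub_surplusCalculus`.  Notation in the comments: `L = log (1/d)`,
`f_d(s) = (W(d+s) − W(d)) / (2s)` (the integrand of the inner pull `J = ∫₀^{d₀−d} f_d`).

* `stub_surplusCalculus_diff_le`: the algebraic Lipschitz bound
  `0 ≤ W(σ) − W(d) ≤ (σ − d) / (2 d · log(1/σ)^{3/2})` for `0 < d ≤ σ < 1`
  (from `log (σ/d) ≤ σ/d − 1`), whence (`stub_surplusCalculus_integrand_le`)
  `0 ≤ f_d(s) ≤ 1/(4 d · log(1/ρ)^{3/2})` whenever `d + s ≤ ρ < 1`; in particular `f_d` is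
  bounded and measurable, hence integrable (`stub_surplusCalculus_integrableOn`), and
  `∫₀^c f_d ≤ c/(4 d · log(1/ρ)^{3/2})` for `d + c ≤ ρ` (`stub_surplusCalculus_head`);
* `stub_surplusCalculus_tail`: for `d ≤ s` one has `W(d+s) ≤ W(2s)`, and
  `s ↦ −√(log (1/(2s))) − log s / (2√L)` is a primitive of `W(2s)/(2s) − W(d)/(2s)`, so
  `∫_d^{d₀} f_d ≤ √(L − log 2) − √(L₀ − log 2) − (L − L₀)/(2√L)` by the FTC inequality
  `intervalIntegral.integral_le_sub_of_hasDeriv_right_of_le`.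
-/

set_option linter.dupNamespace false

noncomputable section

open MeasureTheory Set Filter
open scoped Topology ENNReal NNReal

namespace Summit.RiemannHypothesis.RiemannHypothesis.Theorems.WeilWindowFlowWindowLipschitz

open Literature.NumberTheory.LFunctions

/-! ## Elementary facts about `W(s) = 1/√(log (1/s))` -/

/-- `log (1/x) > 0` for `0 < x < 1`. -/
theorem stub_surplusCalculus_log_pos {x : ℝ} (hx : 0 < x) (hx1 : x < 1) :
    0 < Real.log (1 / x) :=
  Real.log_pos (one_lt_one_div hx hx1)

/-- `log (1/d) − log (1/σ) = log (σ/d) ≤ (σ − d)/d` for `0 < d`, `0 < σ` (registered sub-goal of the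
Aux file; stated in binder-free `∀`-form). -/
theorem stub_surplusCalculus_log_sub_le :
    ∀ {d σ : ℝ}, 0 < d → 0 < σ → Real.log (1 / d) - Real.log (1 / σ) ≤ (σ - d) / d := by
  intro d σ hd hσ
  have h1 : Real.log (1 / d) - Real.log (1 / σ) = Real.log (σ / d) := by
    rw [← Real.log_div (by positivity) (by positivity)]
    congr 1
    field_simp
  rw [h1]
  calc Real.log (σ / d) ≤ σ / d - 1 := Real.log_le_sub_one_of_pos (by positivity)
    _ = (σ - d) / d := by field_simp

/-- The algebraic Lipschitz bound `0 ≤ W(σ) − W(d) ≤ (σ − d)/(2 d log(1/σ)^{3/2})`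
for `0 < d ≤ σ < 1`. -/
theorem stub_surplusCalculus_diff_le {d σ : ℝ} (hd : 0 < d) (hdσ : d ≤ σ) (hσ : σ < 1) :
    0 ≤ 1 / Real.sqrt (Real.log (1 / σ)) - 1 / Real.sqrt (Real.log (1 / d)) ∧
      1 / Real.sqrt (Real.log (1 / σ)) - 1 / Real.sqrt (Real.log (1 / d)) ≤
        (σ - d) / (2 * d * (Real.log (1 / σ) * Real.sqrt (Real.log (1 / σ)))) := by
  have hσ0 : 0 < σ := hd.trans_le hdσ
  have hM : 0 < Real.log (1 / σ) := stub_surplusCalculus_log_pos hσ0 hσ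
  have hML : Real.log (1 / σ) ≤ Real.log (1 / d) :=
    Real.log_le_log (by positivity) (one_div_le_one_div_of_le hd hdσ)
  have hLM : Real.log (1 / d) - Real.log (1 / σ) ≤ (σ - d) / d :=
    stub_surplusCalculus_log_sub_le hd hσ0
  set a := Real.sqrt (Real.log (1 / d)) with ha_def
  set b := Real.sqrt (Real.log (1 / σ)) with hb_def
  have hb : 0 < b := Real.sqrt_pos.2 hM
  have hab : b ≤ a := Real.sqrt_le_sqrt hML
  have ha : 0 < a := hb.trans_le hab
  have ha2 : a ^ 2 = Real.log (1 / d) := Real.sq_sqrt (hM.le.trans hML)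
  have hb2 : b ^ 2 = Real.log (1 / σ) := Real.sq_sqrt hM.le
  refine ⟨sub_nonneg.2 (one_div_le_one_div_of_le hb hab), ?_⟩
  have key : 1 / b - 1 / a = (a ^ 2 - b ^ 2) / ((a + b) * a * b) := by
    field_simp
    ring
  rw [key, ← hb2]
  have hnum : 0 ≤ a ^ 2 - b ^ 2 := by rw [ha2, hb2]; linarith
  have hden : 2 * (b ^ 2 * b) ≤ (a + b) * a * b := by
    have h1 : (a + b) * a * b - 2 * (b ^ 2 * b) = b * (a - b) * (a + 2 * b) := by ring
    have h2 : 0 ≤ b * (a - b) * (a + 2 * b) :=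
      mul_nonneg (mul_nonneg hb.le (sub_nonneg.2 hab)) (by positivity)
    linarith
  calc (a ^ 2 - b ^ 2) / ((a + b) * a * b)
      ≤ (a ^ 2 - b ^ 2) / (2 * (b ^ 2 * b)) :=
        div_le_div_of_nonneg_left hnum (by positivity) hden
    _ ≤ ((σ - d) / d) / (2 * (b ^ 2 * b)) := by
        apply div_le_div_of_nonneg_right _ (by positivity)
        rw [ha2, hb2]
        exact hLM
    _ = (σ - d) / (2 * d * (b ^ 2 * b)) := by
        rw [div_div]
        ring

/-- Bounds for the integrand `f_d(s) = (W(d+s) − W(d))/(2s)` of the inner pull: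
`0 ≤ f_d(s) ≤ 1/(4 d log(1/ρ)^{3/2})` for `0 ≤ s` and `d + s ≤ ρ < 1`. -/
theorem stub_surplusCalculus_integrand_le {d s ρ : ℝ} (hd : 0 < d) (hs : 0 ≤ s)
    (hsρ : d + s ≤ ρ) (hρ : ρ < 1) :
    0 ≤ (1 / Real.sqrt (Real.log (1 / (d + s))) - 1 / Real.sqrt (Real.log (1 / d))) / (2 * s) ∧
      (1 / Real.sqrt (Real.log (1 / (d + s))) - 1 / Real.sqrt (Real.log (1 / d))) / (2 * s) ≤
        1 / (4 * d * (Real.log (1 / ρ) * Real.sqrt (Real.log (1 / ρ)))) := by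
  have hσ1 : d + s < 1 := hsρ.trans_lt hρ
  obtain ⟨h0, h1⟩ := stub_surplusCalculus_diff_le hd (le_add_of_nonneg_right hs) hσ1
  have hρ0 : 0 < ρ := by linarith
  have hR : 0 < Real.log (1 / ρ) := stub_surplusCalculus_log_pos hρ0 hρ
  have hRM : Real.log (1 / ρ) ≤ Real.log (1 / (d + s)) :=
    Real.log_le_log (by positivity) (one_div_le_one_div_of_le (by linarith) hsρ)
  have hR32 : Real.log (1 / ρ) * Real.sqrt (Real.log (1 / ρ)) ≤
      Real.log (1 / (d + s)) * Real.sqrt (Real.log (1 / (d + s))) :=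
    mul_le_mul hRM (Real.sqrt_le_sqrt hRM) (Real.sqrt_nonneg _) (hR.le.trans hRM)
  have hR32pos : 0 < Real.log (1 / ρ) * Real.sqrt (Real.log (1 / ρ)) := by positivity
  have h2 : 1 / Real.sqrt (Real.log (1 / (d + s))) - 1 / Real.sqrt (Real.log (1 / d)) ≤
      s / (2 * d * (Real.log (1 / ρ) * Real.sqrt (Real.log (1 / ρ)))) := by
    refine h1.trans ?_
    rw [add_sub_cancel_left]
    exact div_le_div_of_nonneg_left hs (by positivity) (by gcongr)
  rcases hs.eq_or_lt with h | hs'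
  · subst h
    refine ⟨by simp, ?_⟩
    rw [mul_zero, div_zero]
    positivity
  · refine ⟨div_nonneg h0 (by positivity), ?_⟩
    calc (1 / Real.sqrt (Real.log (1 / (d + s))) - 1 / Real.sqrt (Real.log (1 / d))) / (2 * s)
        ≤ s / (2 * d * (Real.log (1 / ρ) * Real.sqrt (Real.log (1 / ρ)))) / (2 * s) :=
          div_le_div_of_nonneg_right h2 (by positivity)
      _ = 1 / (4 * d * (Real.log (1 / ρ) * Real.sqrt (Real.log (1 / ρ)))) := by
          field_simp
          ring

/-! ## Integrability of the inner-pull integrand -/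

/-- The integrand of the inner pull is measurable (as a total function with junk values). -/
theorem stub_surplusCalculus_measurable (d : ℝ) :
    Measurable (fun s : ℝ =>
      (1 / Real.sqrt (Real.log (1 / (d + s))) - 1 / Real.sqrt (Real.log (1 / d))) / (2 * s)) := by
  fun_prop

/-- The integrand of the inner pull is integrable on `[a, b]` whenever `0 ≤ a` and `d + b < 1`
(it is measurable and bounded there). -/
theorem stub_surplusCalculus_integrableOn {d a b : ℝ} (hd : 0 < d) (ha : 0 ≤ a)
    (hb : d + b < 1) :
    IntegrableOn (fun s : ℝ =>
      (1 / Real.sqrt (Real.log (1 / (d + s))) - 1 / Real.sqrt (Real.log (1 / d))) / (2 * s))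
      (Icc a b) := by
  refine Measure.integrableOn_of_bounded
    (M := 1 / (4 * d * (Real.log (1 / (d + b)) * Real.sqrt (Real.log (1 / (d + b))))))
    measure_Icc_lt_top.ne (stub_surplusCalculus_measurable d).aestronglyMeasurable ?_
  refine ae_restrict_of_forall_mem measurableSet_Icc fun s hs => ?_
  obtain ⟨h0, h1⟩ :=
    stub_surplusCalculus_integrand_le hd (ha.trans hs.1) (by linarith [hs.2] : d + s ≤ d + b) hb
  rw [Real.norm_eq_abs, abs_of_nonneg h0]
  exact h1

/-- Interval integrability of the inner-pull integrand on `[a, b] ⊂ [0, 1 − d)`. -/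
theorem stub_surplusCalculus_intervalIntegrable {d a b : ℝ} (hd : 0 < d) (ha : 0 ≤ a)
    (hab : a ≤ b) (hb : d + b < 1) :
    IntervalIntegrable (fun s : ℝ =>
      (1 / Real.sqrt (Real.log (1 / (d + s))) - 1 / Real.sqrt (Real.log (1 / d))) / (2 * s))
      volume a b :=
  (intervalIntegrable_iff_integrableOn_Icc_of_le hab).2
    (stub_surplusCalculus_integrableOn hd ha hb)

/-! ## The tail of the inner pull: comparison with an explicit primitive -/

/-- For `0 < d ≤ d₀` with `2 d₀ < 1`:
`∫_d^{d₀} f_d ≤ √(L − log 2) − √(L₀ − log 2) − (L − L₀)/(2 √L)`, obtained from `W(d+s) ≤ W(2s)`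
for `s ≥ d` and the primitive `−√(log(1/(2s))) − log s/(2√L)` of `W(2s)/(2s) − W(d)/(2s)`. -/
theorem stub_surplusCalculus_tail {d d₀ : ℝ} (hd : 0 < d) (hdd₀ : d ≤ d₀) (h2d₀ : 2 * d₀ < 1) :
    (∫ s in d..d₀,
        (1 / Real.sqrt (Real.log (1 / (d + s))) - 1 / Real.sqrt (Real.log (1 / d))) / (2 * s)) ≤
      Real.sqrt (Real.log (1 / d) - Real.log 2) - Real.sqrt (Real.log (1 / d₀) - Real.log 2)
        - (Real.log (1 / d) - Real.log (1 / d₀)) / (2 * Real.sqrt (Real.log (1 / d))) := by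
  set L := Real.log (1 / d) with hL
  have hd₀ : 0 < d₀ := hd.trans_le hdd₀
  have key : ∀ s : ℝ, 0 < s → 2 * s < 1 → 0 < -Real.log 2 - Real.log s := by
    intro s hs h2s
    have h : Real.log (2 * s) < 0 := Real.log_neg (by positivity) h2s
    rw [Real.log_mul two_ne_zero hs.ne'] at h
    linarith
  have hderiv : ∀ s : ℝ, 0 < s → 2 * s < 1 →
      HasDerivAt (fun x => -Real.sqrt (-Real.log 2 - Real.log x) - Real.log x / (2 * Real.sqrt L))
        (s⁻¹ / (2 * Real.sqrt (-Real.log 2 - Real.log s)) - s⁻¹ / (2 * Real.sqrt L)) s := by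
    intro s hs h2s
    have h1 : HasDerivAt (fun x => -Real.log 2 - Real.log x) (-s⁻¹) s :=
      (Real.hasDerivAt_log hs.ne').const_sub (-Real.log 2)
    have h2 := h1.sqrt (key s hs h2s).ne'
    have h3 : HasDerivAt (fun x => Real.log x / (2 * Real.sqrt L)) (s⁻¹ / (2 * Real.sqrt L)) s :=
      (Real.hasDerivAt_log hs.ne').div_const _
    exact ((h2.fun_neg).fun_sub h3).congr_deriv (by ring)
  have hlogd : Real.log d = -L := by rw [hL, one_div, Real.log_inv, neg_neg]
  have hlogd₀ : Real.log d₀ = -Real.log (1 / d₀) := by rw [one_div, Real.log_inv, neg_neg]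
  have hmain := intervalIntegral.integral_le_sub_of_hasDeriv_right_of_le
    (g := fun x => -Real.sqrt (-Real.log 2 - Real.log x) - Real.log x / (2 * Real.sqrt L))
    (g' := fun s => s⁻¹ / (2 * Real.sqrt (-Real.log 2 - Real.log s)) - s⁻¹ / (2 * Real.sqrt L))
    (φ := fun s : ℝ =>
      (1 / Real.sqrt (Real.log (1 / (d + s))) - 1 / Real.sqrt L) / (2 * s))
    hdd₀ (fun s hs => (hderiv s (hd.trans_le hs.1) (by linarith [hs.2])).continuousAt
      |>.continuousWithinAt)
    (fun s hs => (hderiv s (hd.trans hs.1) (by linarith [hs.2])).hasDerivWithinAt)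
    (stub_surplusCalculus_integrableOn hd hd.le (by linarith)) ?_
  · refine hmain.trans (le_of_eq ?_)
    have e1 : -Real.log 2 - -Real.log (1 / d₀) = Real.log (1 / d₀) - Real.log 2 := by ring
    have e2 : -Real.log 2 - -L = L - Real.log 2 := by ring
    simp only [hlogd, hlogd₀]
    rw [e1, e2]
    ring
  · intro s hs
    have hs0 : 0 < s := hd.trans hs.1
    have h2s : 2 * s < 1 := by linarith [hs.2]
    have hds : 0 < d + s := by linarith
    have hX := key s hs0 h2s
    have hlog_eq : Real.log (1 / (2 * s)) = -Real.log 2 - Real.log s := by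
      rw [one_div, Real.log_inv, Real.log_mul two_ne_zero hs0.ne']
      ring
    have hmono : -Real.log 2 - Real.log s ≤ Real.log (1 / (d + s)) := by
      rw [← hlog_eq]
      exact Real.log_le_log (by positivity)
        (one_div_le_one_div_of_le hds (by linarith [hs.1]))
    have hW : 1 / Real.sqrt (Real.log (1 / (d + s))) ≤ 1 / Real.sqrt (-Real.log 2 - Real.log s) :=
      one_div_le_one_div_of_le (Real.sqrt_pos.2 hX) (Real.sqrt_le_sqrt hmono)
    have e1 : (1 / Real.sqrt (Real.log (1 / (d + s))) - 1 / Real.sqrt L) / (2 * s) =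
        (1 / Real.sqrt (Real.log (1 / (d + s)))) / (2 * s) - s⁻¹ / (2 * Real.sqrt L) := by
      ring
    have e2 : (1 / Real.sqrt (-Real.log 2 - Real.log s)) / (2 * s) =
        s⁻¹ / (2 * Real.sqrt (-Real.log 2 - Real.log s)) := by
      ring
    have h3 : (1 / Real.sqrt (Real.log (1 / (d + s)))) / (2 * s) ≤
        (1 / Real.sqrt (-Real.log 2 - Real.log s)) / (2 * s) :=
      div_le_div_of_nonneg_right hW (by positivity)
    show (1 / Real.sqrt (Real.log (1 / (d + s))) - 1 / Real.sqrt L) / (2 * s) ≤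
      s⁻¹ / (2 * Real.sqrt (-Real.log 2 - Real.log s)) - s⁻¹ / (2 * Real.sqrt L)
    rw [e1, ← e2]
    linarith

/-! ## The head of the inner pull -/

/-- The inner pull over `[0, c]` is at most `c/(4 d log(1/ρ)^{3/2})` when `d + c ≤ ρ < 1`
(no integrability needed: `intervalIntegral.norm_integral_le_of_norm_le_const`). -/
theorem stub_surplusCalculus_head {d c ρ : ℝ} (hd : 0 < d) (hc : 0 ≤ c) (hcρ : d + c ≤ ρ)
    (hρ : ρ < 1) :
    (∫ s in (0 : ℝ)..c,
        (1 / Real.sqrt (Real.log (1 / (d + s))) - 1 / Real.sqrt (Real.log (1 / d))) / (2 * s)) ≤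
      c / (4 * d * (Real.log (1 / ρ) * Real.sqrt (Real.log (1 / ρ)))) := by
  have hbnd : ∀ s ∈ uIoc (0 : ℝ) c,
      ‖(1 / Real.sqrt (Real.log (1 / (d + s))) - 1 / Real.sqrt (Real.log (1 / d))) / (2 * s)‖ ≤
        1 / (4 * d * (Real.log (1 / ρ) * Real.sqrt (Real.log (1 / ρ)))) := by
    intro s hs
    rw [uIoc_of_le hc] at hs
    obtain ⟨h0, h1⟩ :=
      stub_surplusCalculus_integrand_le hd hs.1.le (by linarith [hs.2] : d + s ≤ ρ) hρ
    rw [Real.norm_eq_abs, abs_of_nonneg h0]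
    exact h1
  have h := intervalIntegral.norm_integral_le_of_norm_le_const hbnd
  rw [sub_zero, abs_of_nonneg hc, Real.norm_eq_abs] at h
  calc _ ≤ 1 / (4 * d * (Real.log (1 / ρ) * Real.sqrt (Real.log (1 / ρ)))) * c :=
        (le_abs_self _).trans h
    _ = c / (4 * d * (Real.log (1 / ρ) * Real.sqrt (Real.log (1 / ρ)))) := by ring

/-- `log 2 ≤ 1`. -/
theorem stub_surplusCalculus_log_two_le : Real.log 2 ≤ 1 := by
  have := Real.log_le_sub_one_of_pos (show (0 : ℝ) < 2 by norm_num)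
  linarith

end Summit.RiemannHypothesis.RiemannHypothesis.Theorems.WeilWindowFlowWindowLipschitz

end
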